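import Literature.MathematicalPhysics.QuantumFieldTheory.OSTimeTubeDerivatives
import Literature.MathematicalPhysics.QuantumFieldTheory.OSTimeTubeRotations
import Literature.MathematicalPhysics.QuantumFieldTheory.OSTimeSpaceSplit
import Literature.MathematicalPhysics.QuantumFieldTheory.OSEuclideanRotationGenerator
import Mathlib.Analysis.Calculus.LineDeriv.IntegrationByParts
import Mathlib.Analysis.Distribution.AEEqOfIntegralContDiff
import HarnessLib

/-!
# The infinitesimal rotation identity of an OS time continuation at imaginary times

Support file (everything proved; no definitions, no named facts) for (B)
`Literature.MathematicalPhysics.QuantumFieldTheory.OS1973_lorentzInvariant_of_timeContinuation`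
(`OSTimeContinuation`; Osterwalder–Schrader I (1973), §4.2, (4.14)–(4.17)). Let `𝔚` be
continuous on the time tube, holomorphic in the times, with Euclidean restriction `𝔖ₙ` on
time-ordered test functions, and let `𝔖ₙ` be Euclidean covariant (E1). In the coordinates
`(w, y) ∈ 𝒯ₙ × (ℝ^d)ⁿ` of `OSTimeTubeCoordinates` write `K_χ(w) = ∫ 𝔚 (tsCfg w y) χ(y) dy` for
the spatial smearings (`OSTimeTubeDerivatives`). The weak infinitesimal rotation invariance
`∫ 𝔚(ιx) Df(x)(Ax) dx = 0` of `OSEuclideanRotationGenerator` (OS I (4.15)), applied to product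
test functions `f(x) = φ(x⁰) ψ(x⃗)` with `φ` supported in the ordered times, becomes after the
time–space Fubini theorem (`OSTimeSpaceSplit`) and an integration by parts in the time `u_k`
(Mathlib's `integral_bilinear_hasLineDerivAt_right_eq_neg_left_of_integrable`, the line
derivative of `u ↦ K_χ(iu)` being `i ∂_k K_χ(iu)`), an identity `∫ φ(u) h(u) du = 0` for all such
`φ`, whence (`IsOpen.ae_eq_zero_of_integral_contDiff_smul_eq_zero`) the **pointwise identity at
imaginary ordered times**

  `∑ₖ ( i ∂ₖ K_{y_k^j ψ} (iu) + u_k K_{∂_{k,j} ψ} (iu) ) = 0`   (`sum_rotGen_smearing_imagTimes_eq_zero`),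

the spatially smeared form of `Y_{0j} Sₙ = 0` in which no spatial derivative falls on `𝔚`. The
sequel `OSTimeTubeRotationIdentity` continues it analytically to the whole complex time tube.

## References

* K. Osterwalder, R. Schrader, *Axioms for Euclidean Green's functions*, Comm. Math. Phys. 31
  (1973) 83–112, §4.2, (4.14)–(4.17). [OsterwalderSchraderCMP1973]
* K. Osterwalder, R. Schrader, *Axioms for Euclidean Green's functions II*, Comm. Math. Phys. 42
  (1975) 281–305, §IV.2 p. 288. [OsterwalderSchraderCMP1975]
-/

noncomputable section

open Filter Complex Set MeasureTheory Metric
open scoped Topology SchwartzMap ContDiff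
open Literature.MathematicalPhysics.QuantumLattice

namespace Literature.MathematicalPhysics.QuantumFieldTheory

variable {d n : ℕ}

/-! ### Product test functions `φ(x⁰) ψ(x⃗)` -/

/-- The times of a configuration depend continuously and linearly on it: as a continuous linear
map. [folklore] -/
theorem exists_clm_times :
    ∃ T : (Fin n → EuclideanSpace ℝ (Fin (d + 1))) →L[ℝ] (Fin n → ℝ), ∀ x, T x = fun k => x k 0 :=
  ⟨ContinuousLinearMap.pi fun k => (EuclideanSpace.proj (0 : Fin (d + 1))).comp
    (ContinuousLinearMap.proj k), fun _ => rfl⟩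

/-- The spatial parts of a configuration depend continuously and linearly on it. [folklore] -/
theorem exists_clm_spaces :
    ∃ P : (Fin n → EuclideanSpace ℝ (Fin (d + 1))) →L[ℝ] (Fin n → EuclideanSpace ℝ (Fin d)),
      ∀ x, P x = fun k => spaceC d (x k) :=
  ⟨ContinuousLinearMap.pi fun k => (spaceC d).comp (ContinuousLinearMap.proj k), fun _ => rfl⟩

/-- **Product test functions are smooth.** [folklore] -/
theorem contDiff_timeSpaceProduct {φ : (Fin n → ℝ) → ℂ} {ψ : (Fin n → EuclideanSpace ℝ (Fin d)) → ℂ}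
    (hφ : ContDiff ℝ ∞ φ) (hψ : ContDiff ℝ ∞ ψ) :
    ContDiff ℝ ∞ fun x : Fin n → EuclideanSpace ℝ (Fin (d + 1)) =>
      φ (fun k => x k 0) * ψ (fun k => spaceC d (x k)) := by
  obtain ⟨T, hT⟩ := exists_clm_times (d := d) (n := n)
  obtain ⟨P, hP⟩ := exists_clm_spaces (d := d) (n := n)
  have h1 : ContDiff ℝ ∞ fun x : Fin n → EuclideanSpace ℝ (Fin (d + 1)) => φ (fun k => x k 0) := by
    have := hφ.comp T.contDiff
    simpa only [Function.comp_def, hT] using this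
  have h2 : ContDiff ℝ ∞ fun x : Fin n → EuclideanSpace ℝ (Fin (d + 1)) => ψ (fun k => spaceC d (x k)) := by
    have := hψ.comp P.contDiff
    simpa only [Function.comp_def, hP] using this
  exact h1.mul h2

/-- **Product test functions have compact support** (the support lies in the assembled image of
`tsupport φ × tsupport ψ`). [folklore] -/
theorem hasCompactSupport_timeSpaceProduct {φ : (Fin n → ℝ) → ℂ}
    {ψ : (Fin n → EuclideanSpace ℝ (Fin d)) → ℂ}
    (hφc : HasCompactSupport φ) (hψc : HasCompactSupport ψ) :
    HasCompactSupport fun x : Fin n → EuclideanSpace ℝ (Fin (d + 1)) =>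
      φ (fun k => x k 0) * ψ (fun k => spaceC d (x k)) := by
  refine HasCompactSupport.of_support_subset_isCompact
    (((hφc.isCompact.prod hψc.isCompact).image continuous_timeSpace)) fun x hx => ?_
  rw [Function.mem_support, mul_ne_zero_iff] at hx
  refine ⟨((fun k => x k 0), fun k => spaceC d (x k)), ⟨subset_tsupport _ hx.1, subset_tsupport _ hx.2⟩, ?_⟩
  funext k
  exact ofTimeSpace_apply_zero_spaceC (x k)

/-- **Product test functions with `φ` supported in the ordered times are supported in `Ω_<`.** [folklore] -/
theorem tsupport_timeSpaceProduct_subset {φ : (Fin n → ℝ) → ℂ}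
    {ψ : (Fin n → EuclideanSpace ℝ (Fin d)) → ℂ} (hφs : tsupport φ ⊆ orderedTimes n) :
    tsupport (fun x : Fin n → EuclideanSpace ℝ (Fin (d + 1)) =>
      φ (fun k => x k 0) * ψ (fun k => spaceC d (x k))) ⊆ timeOrderedRegion d n := by
  intro x hx
  have hcont : Continuous fun x : Fin n → EuclideanSpace ℝ (Fin (d + 1)) => fun k => x k 0 :=
    continuous_pi fun k => (EuclideanSpace.proj (0 : Fin (d + 1))).continuous.comp (continuous_apply k)
  have h1 : tsupport (fun x : Fin n → EuclideanSpace ℝ (Fin (d + 1)) =>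
      φ (fun k => x k 0) * ψ (fun k => spaceC d (x k))) ⊆
      (fun x : Fin n → EuclideanSpace ℝ (Fin (d + 1)) => fun k => x k 0) ⁻¹' tsupport φ := by
    refine closure_minimal (fun x hx => ?_) ((isClosed_tsupport φ).preimage hcont)
    rw [Function.mem_support, mul_ne_zero_iff] at hx
    exact subset_tsupport _ hx.1
  exact mem_timeOrderedRegion_of_succDiff_pos (hφs (h1 hx))

/-- **The derivative of a product test function along the rotation generator**
`(A x)_k = x_k^j e₀ − x_k⁰ e_j`:
`Df(x)(Ax) = (∑ₖ x_k^j ∂ₖφ(x⁰)) ψ(x⃗) − φ(x⁰) ∑ₖ x_k⁰ ∂_{k,j}ψ(x⃗)`. [folklore] -/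
theorem fderiv_timeSpaceProduct_rotGen {φ : (Fin n → ℝ) → ℂ}
    {ψ : (Fin n → EuclideanSpace ℝ (Fin d)) → ℂ} (hφ : ContDiff ℝ ∞ φ) (hψ : ContDiff ℝ ∞ ψ)
    (j : Fin d) (x : Fin n → EuclideanSpace ℝ (Fin (d + 1))) :
    fderiv ℝ (fun x : Fin n → EuclideanSpace ℝ (Fin (d + 1)) =>
        φ (fun k => x k 0) * ψ (fun k => spaceC d (x k))) x
      (fun k => (x k j.succ) • e₀ d - (x k 0) • EuclideanSpace.single j.succ (1 : ℝ)) =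
      (∑ k, ((x k j.succ : ℝ) : ℂ) * fderiv ℝ φ (fun k => x k 0) (Pi.single k 1)) *
          ψ (fun k => spaceC d (x k)) -
        φ (fun k => x k 0) * ∑ k, ((x k 0 : ℝ) : ℂ) *
          fderiv ℝ ψ (fun k => spaceC d (x k)) (Pi.single k (EuclideanSpace.single j (1 : ℝ))) := by
  obtain ⟨T, hT⟩ := exists_clm_times (d := d) (n := n)
  obtain ⟨P, hP⟩ := exists_clm_spaces (d := d) (n := n)
  have hφd : Differentiable ℝ φ := hφ.differentiable (by simp)
  have hψd : Differentiable ℝ ψ := hψ.differentiable (by simp)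
  have hf : HasFDerivAt (fun x : Fin n → EuclideanSpace ℝ (Fin (d + 1)) => φ (T x) * ψ (P x))
      (φ (T x) • ((fderiv ℝ ψ (P x)).comp P) + ψ (P x) • ((fderiv ℝ φ (T x)).comp T)) x :=
    ((hφd _).hasFDerivAt.comp x T.hasFDerivAt).mul ((hψd _).hasFDerivAt.comp x P.hasFDerivAt)
  have hfun : (fun x : Fin n → EuclideanSpace ℝ (Fin (d + 1)) =>
      φ (fun k => x k 0) * ψ (fun k => spaceC d (x k))) = fun x => φ (T x) * ψ (P x) := by
    funext x; rw [hT, hP]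
  rw [hfun, hf.fderiv]
  -- the generator through the two linear maps
  have hTA : T (fun k => (x k j.succ) • e₀ d - (x k 0) • EuclideanSpace.single j.succ (1 : ℝ)) =
      ∑ k, (x k j.succ) • (Pi.single k (1 : ℝ) : Fin n → ℝ) := by
    rw [hT]
    have hne : (0 : Fin (d + 1)) ≠ j.succ := (Fin.succ_ne_zero j).symm
    have h1 : (fun k => ((x k j.succ) • e₀ d - (x k 0) • EuclideanSpace.single j.succ (1 : ℝ)) 0) =
        fun k => x k j.succ := by
      funext k; simp [hne]
    rw [h1]
    conv_lhs => rw [← Finset.univ_sum_single fun k => x k j.succ]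
    refine Finset.sum_congr rfl fun k _ => ?_
    rw [← Pi.single_smul', smul_eq_mul, mul_one]
  have hPA : P (fun k => (x k j.succ) • e₀ d - (x k 0) • EuclideanSpace.single j.succ (1 : ℝ)) =
      ∑ k, (-(x k 0)) • (Pi.single k (EuclideanSpace.single j (1 : ℝ)) :
        Fin n → EuclideanSpace ℝ (Fin d)) := by
    rw [hP]
    have h1 : (fun k => spaceC d ((x k j.succ) • e₀ d - (x k 0) • EuclideanSpace.single j.succ (1 : ℝ))) =
        fun k => (-(x k 0)) • EuclideanSpace.single j (1 : ℝ) := by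
      funext k
      ext i
      simp [spaceC_apply, Fin.succ_ne_zero, PiLp.single_apply, Fin.succ_inj]
    rw [h1]
    conv_lhs => rw [← Finset.univ_sum_single fun k => (-(x k 0)) • EuclideanSpace.single j (1 : ℝ)]
    refine Finset.sum_congr rfl fun k _ => ?_
    rw [← Pi.single_smul']
  simp only [add_apply, smul_apply,
    ContinuousLinearMap.comp_apply, hTA, hPA, map_sum, map_smul, smul_eq_mul, hT, hP]
  simp only [Finset.mul_sum, neg_smul, Complex.real_smul]
  ring_nf
  rw [Finset.sum_neg_distrib, Finset.mul_sum, neg_add_eq_sub]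
  congr 1
  exact Finset.sum_congr rfl fun k _ => by ring

/-! ### Smearings at imaginary times as functions of the real times -/

/-- `imagTimes` is continuous. [folklore] -/
theorem continuous_imagTimes : Continuous (imagTimes : (Fin n → ℝ) → Fin n → ℂ) :=
  continuous_pi fun k => continuous_const.mul (continuous_ofReal.comp (continuous_apply k))

/-- `imagTimes` along a real line: `i(u + t v) = iu + t (iv)`. [folklore] -/
theorem imagTimes_add_smul (u v : Fin n → ℝ) (t : ℝ) :
    imagTimes (u + t • v) = imagTimes u + (t : ℂ) • imagTimes v := by
  funext k
  simp only [imagTimes_apply, Pi.add_apply, Pi.smul_apply, smul_eq_mul]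
  push_cast
  ring

/-- `imagTimes` of a coordinate vector: `i e_k`. [folklore] -/
theorem imagTimes_single (k : Fin n) :
    imagTimes (Pi.single k (1 : ℝ)) = I • (Pi.single k (1 : ℂ) : Fin n → ℂ) := by
  funext k'
  by_cases h : k' = k
  · subst h; simp
  · simp [h]

variable {𝔚 : (Fin n → Fin (d + 1) → ℂ) → ℂ}

/-- **Smearings at imaginary times are continuous in the ordered real times.** [folklore] -/
theorem continuousOn_smearing_imagTimes (hc : ContinuousOn 𝔚 (timeTube d n))
    (hh : IsTimeHolomorphicOn 𝔚 (timeTube d n)) {χ : (Fin n → EuclideanSpace ℝ (Fin d)) → ℂ}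
    (hχ : Continuous χ) (hχc : HasCompactSupport χ) :
    ContinuousOn (fun u : Fin n → ℝ => ∫ y, 𝔚 (tsCfg (imagTimes u) y) * χ y) (orderedTimes n) :=
  (differentiableOn_integral_tsCfg_mul hc hh hχ hχc).continuousOn.comp
    continuous_imagTimes.continuousOn fun u hu => (imagTimes_mem_cTimeTube_iff u).2 hu

/-- **Time derivatives of smearings at imaginary times are continuous in the ordered real times.** [folklore] -/
theorem continuousOn_fderiv_smearing_imagTimes (hc : ContinuousOn 𝔚 (timeTube d n))
    (hh : IsTimeHolomorphicOn 𝔚 (timeTube d n)) {χ : (Fin n → EuclideanSpace ℝ (Fin d)) → ℂ}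
    (hχ : Continuous χ) (hχc : HasCompactSupport χ) (v : Fin n → ℂ) :
    ContinuousOn (fun u : Fin n → ℝ =>
      fderiv ℂ (fun w => ∫ y, 𝔚 (tsCfg w y) * χ y) (imagTimes u) v) (orderedTimes n) := by
  have h := (Literature.Analysis.Complex.SCV.continuousOn_fderiv
    (differentiableOn_integral_tsCfg_mul hc hh hχ hχc) isOpen_cTimeTube).clm_apply
    (continuousOn_const (c := v))
  exact h.comp continuous_imagTimes.continuousOn fun u hu => (imagTimes_mem_cTimeTube_iff u).2 hu

/-- **The line derivative of a smearing at imaginary times along the `k`-th real time** is the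
complex time derivative in the direction `i e_k`. [folklore] -/
theorem hasLineDerivAt_smearing_imagTimes (hc : ContinuousOn 𝔚 (timeTube d n))
    (hh : IsTimeHolomorphicOn 𝔚 (timeTube d n)) {χ : (Fin n → EuclideanSpace ℝ (Fin d)) → ℂ}
    (hχ : Continuous χ) (hχc : HasCompactSupport χ) {u : Fin n → ℝ} (hu : u ∈ orderedTimes n)
    (k : Fin n) :
    HasLineDerivAt ℝ (fun u : Fin n → ℝ => ∫ y, 𝔚 (tsCfg (imagTimes u) y) * χ y)
      (fderiv ℂ (fun w => ∫ y, 𝔚 (tsCfg w y) * χ y) (imagTimes u)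
        (I • (Pi.single k (1 : ℂ) : Fin n → ℂ))) u (Pi.single k 1) := by
  have hw : imagTimes u + ((0 : ℝ) : ℂ) • (I • (Pi.single k (1 : ℂ) : Fin n → ℂ)) ∈ cTimeTube n := by
    simpa using (imagTimes_mem_cTimeTube_iff u).2 hu
  have h := hasDerivAt_integral_tsCfg_add_ofReal_smul hc hh hχ hχc hw
  simp only [ofReal_zero, zero_smul, add_zero] at h
  rw [← fderiv_integral_tsCfg_mul hc hh hχ hχc ((imagTimes_mem_cTimeTube_iff u).2 hu)] at h
  show HasDerivAt (fun t : ℝ => ∫ y, 𝔚 (tsCfg (imagTimes (u + t • Pi.single k 1)) y) * χ y) _ 0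
  have hfun : (fun t : ℝ => ∫ y, 𝔚 (tsCfg (imagTimes (u + t • Pi.single k 1)) y) * χ y) =
      fun t : ℝ => ∫ y, 𝔚 (tsCfg (imagTimes u + (t : ℂ) • (I • (Pi.single k (1 : ℂ) : Fin n → ℂ))) y) * χ y := by
    funext t
    rw [imagTimes_add_smul, imagTimes_single]
  rw [hfun]
  exact h

/-- A continuous function on an open set times a continuous function supported inside it is
integrable when the latter has compact support. [folklore] -/
theorem integrable_mul_of_tsupport_subset {X : Type*} [TopologicalSpace X] [MeasurableSpace X]
    [OpensMeasurableSpace X] [T2Space X] {μ : Measure X} [IsFiniteMeasureOnCompacts μ]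
    {U : Set X} (hU : IsOpen U) {G φ : X → ℂ} (hG : ContinuousOn G U) (hφ : Continuous φ)
    (hφc : HasCompactSupport φ) (hsupp : tsupport φ ⊆ U) : Integrable (fun x => G x * φ x) μ :=
  (continuous_mul_of_tsupport_subset hU hG hφ hsupp).integrable_of_hasCompactSupport hφc.mul_left

/-- **Integration by parts in one real time against a smearing at imaginary times**: for `φ`
smooth and compactly supported in the ordered times,
`∫ K_χ(iu) ∂ₖφ(u) du = −∫ ∂_{i e_k} K_χ(iu) φ(u) du`. [folklore] -/
theorem integral_smearing_imagTimes_mul_fderiv (hc : ContinuousOn 𝔚 (timeTube d n))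
    (hh : IsTimeHolomorphicOn 𝔚 (timeTube d n)) {χ : (Fin n → EuclideanSpace ℝ (Fin d)) → ℂ}
    (hχ : Continuous χ) (hχc : HasCompactSupport χ) {φ : (Fin n → ℝ) → ℂ} (hφ : ContDiff ℝ ∞ φ)
    (hφc : HasCompactSupport φ) (hφs : tsupport φ ⊆ orderedTimes n) (k : Fin n) :
    ∫ u, (∫ y, 𝔚 (tsCfg (imagTimes u) y) * χ y) * fderiv ℝ φ u (Pi.single k 1) =
      -∫ u, fderiv ℂ (fun w => ∫ y, 𝔚 (tsCfg w y) * χ y) (imagTimes u)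
        (I • (Pi.single k (1 : ℂ) : Fin n → ℂ)) * φ u := by
  have hφd : Differentiable ℝ φ := hφ.differentiable (by simp)
  have hφ'c : Continuous fun u => fderiv ℝ φ u (Pi.single k 1) :=
    (hφ.continuous_fderiv (by simp)).clm_apply continuous_const
  have hφ'cs : HasCompactSupport fun u => fderiv ℝ φ u (Pi.single k 1) := hφc.fderiv_apply ℝ _
  have hφ's : tsupport (fun u => fderiv ℝ φ u (Pi.single k 1)) ⊆ orderedTimes n :=
    (tsupport_fderiv_apply_subset ℝ (Pi.single k 1)).trans hφs
  have hG := continuousOn_smearing_imagTimes hc hh hχ hχc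
  have hG' := continuousOn_fderiv_smearing_imagTimes hc hh hχ hχc (I • (Pi.single k (1 : ℂ) : Fin n → ℂ))
  have h := integral_bilinear_hasLineDerivAt_right_eq_neg_left_of_integrable
    (μ := (volume : Measure (Fin n → ℝ))) (B := ContinuousLinearMap.mul ℝ ℂ) (v := Pi.single k 1)
    (f := fun u : Fin n → ℝ => ∫ y, 𝔚 (tsCfg (imagTimes u) y) * χ y)
    (f' := fun u => fderiv ℂ (fun w => ∫ y, 𝔚 (tsCfg w y) * χ y) (imagTimes u)
      (I • (Pi.single k (1 : ℂ) : Fin n → ℂ)))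
    (g := φ) (g' := fun u => fderiv ℝ φ u (Pi.single k 1))
    (by simpa using integrable_mul_of_tsupport_subset isOpen_orderedTimes hG' hφ.continuous hφc hφs)
    (by simpa using integrable_mul_of_tsupport_subset isOpen_orderedTimes hG hφ'c hφ'cs hφ's)
    (by simpa using integrable_mul_of_tsupport_subset isOpen_orderedTimes hG hφ.continuous hφc hφs)
    (fun u hu => hasLineDerivAt_smearing_imagTimes hc hh hχ hχc (hφs hu) k)
    (fun u _ => (hφd u).hasFDerivAt.hasLineDerivAt _)
  simpa using h

/-! ### The identity at imaginary ordered times -/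

/-- Euclidean points of assembled configurations, unfolded form of `euclideanPoint_tsReal`. [folklore] -/
theorem euclideanPoint_ofTimeSpace (u : Fin n → ℝ) (y : Fin n → EuclideanSpace ℝ (Fin d)) :
    euclideanPoint (fun k => ofTimeSpace (u k) (y k)) = tsCfg (imagTimes u) y :=
  euclideanPoint_tsReal u y

variable {S : SchwingerFamily (EuclideanSpace ℝ (Fin (d + 1)))}

/-- **The weak rotation identity on product test functions, after the time–space Fubini theorem**:
under E1 and the Euclidean formula, for `φ` smooth compactly supported in the ordered times and
`ψ` smooth compactly supported,
`∫ ( ∑ₖ K_{y_k^j ψ}(iu) ∂ₖφ(u) − φ(u) ∑ₖ u_k K_{∂_{k,j}ψ}(iu) ) du = 0`. [cite: OsterwalderSchraderCMP1973, §4.2 eq. (4.15)] -/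
theorem integral_rotGen_timeSpaceProduct_eq_zero (hE1 : S.IsEuclideanCovariant)
    (hc : ContinuousOn 𝔚 (timeTube d n))
    (hS : ∀ F : 𝓢((Fin n → EuclideanSpace ℝ (Fin (d + 1))), ℂ), IsTimeOrdered F →
      S n F = ∫ x, 𝔚 (euclideanPoint x) * F x)
    (j : Fin d) {φ : (Fin n → ℝ) → ℂ} (hφ : ContDiff ℝ ∞ φ) (hφc : HasCompactSupport φ)
    (hφs : tsupport φ ⊆ orderedTimes n) {ψ : (Fin n → EuclideanSpace ℝ (Fin d)) → ℂ}
    (hψ : ContDiff ℝ ∞ ψ) (hψc : HasCompactSupport ψ) :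
    ∫ u : Fin n → ℝ, ((∑ k, (∫ y, 𝔚 (tsCfg (imagTimes u) y) * (((y k j : ℝ) : ℂ) * ψ y)) *
        fderiv ℝ φ u (Pi.single k 1)) -
      φ u * ∑ k, ((u k : ℝ) : ℂ) * ∫ y, 𝔚 (tsCfg (imagTimes u) y) *
        fderiv ℝ ψ y (Pi.single k (EuclideanSpace.single j (1 : ℝ)))) = 0 := by
  have hf := contDiff_timeSpaceProduct hφ hψ
  have hfc := hasCompactSupport_timeSpaceProduct (d := d) hφc hψc
  have hfs := tsupport_timeSpaceProduct_subset (d := d) (ψ := ψ) hφs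
  have h0 := integral_euclideanPoint_mul_fderiv_rotGen_eq_zero hE1 hc.euclideanPoint_of_timeTube hS j
    hf hfc hfs
  -- integrability of the Euclidean integrand, for Fubini
  have hAc : Continuous fun (x : Fin n → EuclideanSpace ℝ (Fin (d + 1))) (k : Fin n) =>
      (x k j.succ) • e₀ d - (x k 0) • EuclideanSpace.single j.succ (1 : ℝ) := by
    refine continuous_pi fun k => ?_
    have h1 : Continuous fun x : Fin n → EuclideanSpace ℝ (Fin (d + 1)) => x k j.succ :=
      (EuclideanSpace.proj j.succ).continuous.comp (continuous_apply k)
    have h2 : Continuous fun x : Fin n → EuclideanSpace ℝ (Fin (d + 1)) => x k 0 :=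
      (EuclideanSpace.proj 0).continuous.comp (continuous_apply k)
    exact (h1.smul continuous_const).sub (h2.smul continuous_const)
  have hgc : Continuous fun x : Fin n → EuclideanSpace ℝ (Fin (d + 1)) =>
      fderiv ℝ (fun x : Fin n → EuclideanSpace ℝ (Fin (d + 1)) =>
        φ (fun k => x k 0) * ψ (fun k => spaceC d (x k))) x
        (fun k => (x k j.succ) • e₀ d - (x k 0) • EuclideanSpace.single j.succ (1 : ℝ)) :=
    (hf.continuous_fderiv (by simp)).clm_apply hAc
  have hgsupp : Function.support (fun x : Fin n → EuclideanSpace ℝ (Fin (d + 1)) =>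
      fderiv ℝ (fun x : Fin n → EuclideanSpace ℝ (Fin (d + 1)) =>
        φ (fun k => x k 0) * ψ (fun k => spaceC d (x k))) x
        (fun k => (x k j.succ) • e₀ d - (x k 0) • EuclideanSpace.single j.succ (1 : ℝ))) ⊆
      tsupport (fun x : Fin n → EuclideanSpace ℝ (Fin (d + 1)) =>
        φ (fun k => x k 0) * ψ (fun k => spaceC d (x k))) := by
    intro x hx
    rw [Function.mem_support] at hx
    by_contra hx'
    exact hx (by rw [fderiv_of_notMem_tsupport ℝ hx']; rfl)
  have hint : Integrable fun x : Fin n → EuclideanSpace ℝ (Fin (d + 1)) =>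
      𝔚 (euclideanPoint x) * fderiv ℝ (fun x : Fin n → EuclideanSpace ℝ (Fin (d + 1)) =>
        φ (fun k => x k 0) * ψ (fun k => spaceC d (x k))) x
        (fun k => (x k j.succ) • e₀ d - (x k 0) • EuclideanSpace.single j.succ (1 : ℝ)) :=
    integrable_mul_of_tsupport_subset isOpen_timeOrderedRegion hc.euclideanPoint_of_timeTube hgc
      (HasCompactSupport.of_support_subset_isCompact hfc hgsupp)
      ((closure_minimal hgsupp (isClosed_tsupport _)).trans hfs)
  rw [integral_eq_integral_integral_timeSpace hint] at h0
  simp only [fderiv_timeSpaceProduct_rotGen hφ hψ j] at h0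
  simp only [ofTimeSpace_apply_zero, ofTimeSpace_apply_succ, spaceC_ofTimeSpace,
    euclideanPoint_ofTimeSpace] at h0
  -- the inner integrals
  have hinner : ∀ u : Fin n → ℝ,
      ∫ y : Fin n → EuclideanSpace ℝ (Fin d), 𝔚 (tsCfg (imagTimes u) y) *
        ((∑ k, ((y k j : ℝ) : ℂ) * fderiv ℝ φ u (Pi.single k 1)) * ψ y -
          φ u * ∑ k, ((u k : ℝ) : ℂ) * fderiv ℝ ψ y (Pi.single k (EuclideanSpace.single j (1 : ℝ)))) =
      (∑ k, (∫ y, 𝔚 (tsCfg (imagTimes u) y) * (((y k j : ℝ) : ℂ) * ψ y)) *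
          fderiv ℝ φ u (Pi.single k 1)) -
        φ u * ∑ k, ((u k : ℝ) : ℂ) * ∫ y, 𝔚 (tsCfg (imagTimes u) y) *
          fderiv ℝ ψ y (Pi.single k (EuclideanSpace.single j (1 : ℝ))) := by
    intro u
    have hpt : ∀ y : Fin n → EuclideanSpace ℝ (Fin d), 𝔚 (tsCfg (imagTimes u) y) *
        ((∑ k, ((y k j : ℝ) : ℂ) * fderiv ℝ φ u (Pi.single k 1)) * ψ y -
          φ u * ∑ k, ((u k : ℝ) : ℂ) * fderiv ℝ ψ y (Pi.single k (EuclideanSpace.single j (1 : ℝ)))) =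
        (∑ k, fderiv ℝ φ u (Pi.single k 1) * (𝔚 (tsCfg (imagTimes u) y) * (((y k j : ℝ) : ℂ) * ψ y))) -
          ∑ k, (φ u * ((u k : ℝ) : ℂ)) * (𝔚 (tsCfg (imagTimes u) y) *
            fderiv ℝ ψ y (Pi.single k (EuclideanSpace.single j (1 : ℝ)))) := by
      intro y
      rw [mul_sub, Finset.sum_mul, Finset.mul_sum, Finset.mul_sum, Finset.mul_sum]
      congr 1
      · exact Finset.sum_congr rfl fun k _ => by ring
      · exact Finset.sum_congr rfl fun k _ => by ring
    simp_rw [hpt]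
    by_cases hu : u ∈ orderedTimes n
    · have hwu : imagTimes u ∈ cTimeTube n := (imagTimes_mem_cTimeTube_iff u).2 hu
      have hW : Continuous fun y => 𝔚 (tsCfg (imagTimes u) y) := hc.tsCfg_space hwu
      have hI1 : ∀ k, Integrable fun y : Fin n → EuclideanSpace ℝ (Fin d) =>
          𝔚 (tsCfg (imagTimes u) y) * (((y k j : ℝ) : ℂ) * ψ y) := fun k =>
        (hW.mul ((continuous_ofReal.comp ((EuclideanSpace.proj j).continuous.comp
          (continuous_apply k))).mul hψ.continuous)).integrable_of_hasCompactSupport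
          (hψc.mul_left.mul_left)
      have hI2 : ∀ k, Integrable fun y : Fin n → EuclideanSpace ℝ (Fin d) =>
          𝔚 (tsCfg (imagTimes u) y) * fderiv ℝ ψ y (Pi.single k (EuclideanSpace.single j (1 : ℝ))) :=
        fun k => (hW.mul ((hψ.continuous_fderiv (by simp)).clm_apply continuous_const))
          |>.integrable_of_hasCompactSupport ((hψc.fderiv_apply ℝ _).mul_left)
      rw [integral_sub (integrable_finsetSum _ fun k _ => (hI1 k).const_mul _)
        (integrable_finsetSum _ fun k _ => (hI2 k).const_mul _),
        integral_finsetSum _ fun k _ => (hI1 k).const_mul _,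
        integral_finsetSum _ fun k _ => (hI2 k).const_mul _]
      simp only [integral_const_mul]
      rw [Finset.mul_sum]
      congr 1
      · exact Finset.sum_congr rfl fun k _ => by ring
      · exact Finset.sum_congr rfl fun k _ => by ring
    · have hu' : u ∉ tsupport φ := fun h => hu (hφs h)
      have h1 : φ u = 0 := image_eq_zero_of_notMem_tsupport hu'
      have h2 : fderiv ℝ φ u = 0 := fderiv_of_notMem_tsupport ℝ hu'
      simp [h1, h2]
  simp only [hinner] at h0
  exact h0

/-- **The infinitesimal rotation identity at imaginary ordered times** (the spatially smeared
form of Osterwalder–Schrader's `Y_{0j} Sₙ = 0`, OS I (4.15), for an OS time continuation): under E1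
and the Euclidean formula, for `ψ` smooth compactly supported and `u` ordered,
`∑ₖ ( i ∂ₖ K_{y_k^j ψ}(iu) + u_k K_{∂_{k,j}ψ}(iu) ) = 0`, where `K_χ(w) = ∫ 𝔚 (tsCfg w y) χ(y) dy`
and `∂ₖ` is the complex derivative in the `k`-th time. [cite: OsterwalderSchraderCMP1973, §4.2 eqs. (4.14)–(4.15)] -/
theorem sum_rotGen_smearing_imagTimes_eq_zero (hE1 : S.IsEuclideanCovariant)
    (hc : ContinuousOn 𝔚 (timeTube d n)) (hh : IsTimeHolomorphicOn 𝔚 (timeTube d n))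
    (hS : ∀ F : 𝓢((Fin n → EuclideanSpace ℝ (Fin (d + 1))), ℂ), IsTimeOrdered F →
      S n F = ∫ x, 𝔚 (euclideanPoint x) * F x)
    (j : Fin d) {ψ : (Fin n → EuclideanSpace ℝ (Fin d)) → ℂ} (hψ : ContDiff ℝ ∞ ψ)
    (hψc : HasCompactSupport ψ) {u : Fin n → ℝ} (hu : u ∈ orderedTimes n) :
    ∑ k, (I * fderiv ℂ (fun w => ∫ y, 𝔚 (tsCfg w y) * (((y k j : ℝ) : ℂ) * ψ y)) (imagTimes u)
        (Pi.single k 1) +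
      ((u k : ℝ) : ℂ) * ∫ y, 𝔚 (tsCfg (imagTimes u) y) *
        fderiv ℝ ψ y (Pi.single k (EuclideanSpace.single j (1 : ℝ)))) = 0 := by
  -- the spatial test functions
  have hχ : ∀ k : Fin n, Continuous fun y : Fin n → EuclideanSpace ℝ (Fin d) =>
      ((y k j : ℝ) : ℂ) * ψ y := fun k =>
    (continuous_ofReal.comp ((EuclideanSpace.proj j).continuous.comp (continuous_apply k))).mul
      hψ.continuous
  have hχc : ∀ k : Fin n, HasCompactSupport fun y : Fin n → EuclideanSpace ℝ (Fin d) =>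
      ((y k j : ℝ) : ℂ) * ψ y := fun k => hψc.mul_left
  have hψ' : ∀ k : Fin n, Continuous fun y : Fin n → EuclideanSpace ℝ (Fin d) =>
      fderiv ℝ ψ y (Pi.single k (EuclideanSpace.single j (1 : ℝ))) := fun k =>
    (hψ.continuous_fderiv (by simp)).clm_apply continuous_const
  have hψ'c : ∀ k : Fin n, HasCompactSupport fun y : Fin n → EuclideanSpace ℝ (Fin d) =>
      fderiv ℝ ψ y (Pi.single k (EuclideanSpace.single j (1 : ℝ))) := fun k => hψc.fderiv_apply ℝ _
  -- the continuous function of the real times which we show to vanish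
  set D : Fin n → (Fin n → ℝ) → ℂ := fun k u =>
    fderiv ℂ (fun w => ∫ y, 𝔚 (tsCfg w y) * (((y k j : ℝ) : ℂ) * ψ y)) (imagTimes u)
      (I • (Pi.single k (1 : ℂ) : Fin n → ℂ)) with hD
  set H : Fin n → (Fin n → ℝ) → ℂ := fun k u =>
    ∫ y, 𝔚 (tsCfg (imagTimes u) y) * fderiv ℝ ψ y (Pi.single k (EuclideanSpace.single j (1 : ℝ))) with hH
  set G : Fin n → (Fin n → ℝ) → ℂ := fun k u =>
    ∫ y, 𝔚 (tsCfg (imagTimes u) y) * (((y k j : ℝ) : ℂ) * ψ y) with hG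
  set h : (Fin n → ℝ) → ℂ := fun u => ∑ k, (D k u + ((u k : ℝ) : ℂ) * H k u) with hh_def
  have hDc : ∀ k, ContinuousOn (D k) (orderedTimes n) := fun k =>
    continuousOn_fderiv_smearing_imagTimes hc hh (hχ k) (hχc k) _
  have hHc : ∀ k, ContinuousOn (H k) (orderedTimes n) := fun k =>
    continuousOn_smearing_imagTimes hc hh (hψ' k) (hψ'c k)
  have hGc : ∀ k, ContinuousOn (G k) (orderedTimes n) := fun k =>
    continuousOn_smearing_imagTimes hc hh (hχ k) (hχc k)
  have huHc : ContinuousOn (fun u => ∑ k, ((u k : ℝ) : ℂ) * H k u) (orderedTimes n) :=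
    continuousOn_finsetSum _ fun k _ =>
      (continuous_ofReal.comp (continuous_apply k)).continuousOn.mul (hHc k)
  have hhc : ContinuousOn h (orderedTimes n) :=
    continuousOn_finsetSum _ fun k _ =>
      (hDc k).add ((continuous_ofReal.comp (continuous_apply k)).continuousOn.mul (hHc k))
  -- `∫ g • h = 0` for all real smooth `g` compactly supported in the ordered times
  have hweak : ∀ g : (Fin n → ℝ) → ℝ, ContDiff ℝ ∞ g → HasCompactSupport g →
      tsupport g ⊆ orderedTimes n → ∫ u, g u • h u = 0 := by
    intro g hg hgc hgs
    set φ : (Fin n → ℝ) → ℂ := fun u => (g u : ℂ) with hφ_def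
    have hφ : ContDiff ℝ ∞ φ := ofRealCLM.contDiff.comp hg
    have hφc : HasCompactSupport φ := hgc.comp_left Complex.ofReal_zero
    have hφs : tsupport φ ⊆ orderedTimes n := (tsupport_comp_subset Complex.ofReal_zero g).trans hgs
    have hφ'c : ∀ k, Continuous fun u => fderiv ℝ φ u (Pi.single k 1) := fun k =>
      (hφ.continuous_fderiv (by simp)).clm_apply continuous_const
    have hφ'cs : ∀ k, HasCompactSupport fun u => fderiv ℝ φ u (Pi.single k 1) :=
      fun k => hφc.fderiv_apply ℝ _
    have hφ's : ∀ k, tsupport (fun u => fderiv ℝ φ u (Pi.single k 1)) ⊆ orderedTimes n :=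
      fun k => (tsupport_fderiv_apply_subset ℝ (Pi.single k 1)).trans hφs
    have h0 := integral_rotGen_timeSpaceProduct_eq_zero hE1 hc hS j hφ hφc hφs hψ hψc
    -- integrability of the pieces
    have hIGφ' : ∀ k, Integrable fun u => G k u * fderiv ℝ φ u (Pi.single k 1) := fun k =>
      integrable_mul_of_tsupport_subset isOpen_orderedTimes (hGc k) (hφ'c k) (hφ'cs k) (hφ's k)
    have hIDφ : ∀ k, Integrable fun u => D k u * φ u := fun k =>
      integrable_mul_of_tsupport_subset isOpen_orderedTimes (hDc k) hφ.continuous hφc hφs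
    have hIuHφ : Integrable fun u => φ u * ∑ k, ((u k : ℝ) : ℂ) * H k u :=
      (integrable_mul_of_tsupport_subset isOpen_orderedTimes huHc hφ.continuous hφc hφs).congr
        (Eventually.of_forall fun u => mul_comm _ _)
    -- by parts in each time
    have hbp : ∀ k, ∫ u, G k u * fderiv ℝ φ u (Pi.single k 1) = -∫ u, D k u * φ u := fun k =>
      integral_smearing_imagTimes_mul_fderiv hc hh (hχ k) (hχc k) hφ hφc hφs k
    have h1 : (∫ u, ∑ k, G k u * fderiv ℝ φ u (Pi.single k 1)) - ∫ u, φ u * ∑ k, ((u k : ℝ) : ℂ) * H k u = 0 := by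
      rw [← integral_sub (integrable_finsetSum _ fun k _ => hIGφ' k) hIuHφ]
      exact h0
    rw [integral_finsetSum _ fun k _ => hIGφ' k] at h1
    simp only [hbp] at h1
    rw [Finset.sum_neg_distrib, ← integral_finsetSum _ fun k _ => hIDφ k, ← neg_add', neg_eq_zero,
      ← integral_add (integrable_finsetSum _ fun k _ => hIDφ k) hIuHφ] at h1
    have h2 : ∫ u, φ u * h u = 0 := by
      rw [← h1]
      congr 1
      funext u
      simp only [hh_def, Finset.mul_sum, mul_add]
      rw [Finset.sum_add_distrib]
      congr 1
      exact Finset.sum_congr rfl fun k _ => by ring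
    simpa only [hφ_def, Complex.real_smul] using h2
  -- conclude pointwise
  have hae : ∀ᵐ u ∂(volume : Measure (Fin n → ℝ)), u ∈ orderedTimes n → h u = 0 :=
    isOpen_orderedTimes.ae_eq_zero_of_integral_contDiff_smul_eq_zero
      (hhc.locallyIntegrableOn isOpen_orderedTimes.measurableSet) hweak
  have hae' : h =ᵐ[volume.restrict (orderedTimes n)] 0 := by
    rw [Filter.EventuallyEq, ae_restrict_iff' isOpen_orderedTimes.measurableSet]
    exact hae
  have hzero : h u = 0 :=
    Measure.eqOn_open_of_ae_eq hae' isOpen_orderedTimes hhc continuousOn_const hu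
  simp only [hh_def, hD, map_smul, smul_eq_mul] at hzero
  exact hzero

end Literature.MathematicalPhysics.QuantumFieldTheory
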